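import Mathlib
import Literature.Combinatorics.Additive.TripleProductProperty
import Literature.Computability.AlgebraicComplexity.GroupTheoreticMatMul
import Literature.Computability.AutomaticStructures.AutomaticBlock
import Summits.MatrixMultiplication.MatrixMultiplication.Theorems.AutomaticSTPPDesignsBlockTensorTransferKStar

/-!
# Block-tensor transfer, part II: the block-tensor languages of a finite design

Support item `BlockTensorTransfer` (stmt-MatrixMultiplication-7361) of route
MatrixMultiplication/AutomaticSTPPDesigns, helper file 2/3.

Fix a block length `K ≥ 1`, a base `p`, a modulus `N` and a *coding* `c : ZMod N → (Fin K → Fin p)`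
of residues by `K`-digit words with `[c s]_p = s.val` (in the application: the base-`p` digits of the
representative in `[0, N)`, `N ≤ p^K`). For a family `D : ι → Finset (ZMod N)` the *block words* are
the words `(i, c s 0) (i, c s 1) ⋯ (i, c s (K-1))` (index track constant `= i`, digit track = the
code of some `s ∈ D i`), and the *block-tensor language* of `D` is their Kleene star

  `𝓛 D = {z | ∃ i s, s ∈ D i ∧ z = List.ofFn (fun j => (i, c s j))}∗`

(written out in every statement; this file introduces no definitions). Its blocks
(`Literature.Computability.AutomaticStructures.automaticBlock`, definitionally the route's `blk`):
* `ofFn_mem_blockLang_iff` / `mem_automaticBlock_blockLang_iff` — at scale `m * K` the accepted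
  words over an index word `w` are: `w` block-constant with values `i : Fin m → ι`, digit track the
  concatenation of the codes of some `e t ∈ D (i t)`; so the block over `w` is
  `{∑_t [c (e t)]_p · p^(K t)}` and (`card_automaticBlock_blockLang`) has `∏_t |D (i t)|` elements;
* `addSimultaneousTPP_automaticBlock_blockLang` — **no carries**: for an STPP design `(A, B, C)` in
  `ZMod N` with `3 N ≤ p^K` the block families form an STPP family in `ZMod (p^k)` at EVERY scale
  `k` (`k ∉ Kℕ`: empty blocks; `k = m K`: an STPP relation has block "digits" of absolute value
  `≤ 3(N-1) < p^K`, so they all vanish (`eq_zero_of_pow_dvd_sum`) and the design's STPP applies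
  blockwise — CKSU 2005, Lemma 5.4 made carry-free);
* `pow_sum_rpow_le_sum_automaticBlock_blockLang` — at scale `m K` the packing sum at exponent `τ` is
  at least `(∑_i (|A i| |B i| |C i|)^τ)^m`.
-/

-- the tree's namespace `Summit.MatrixMultiplication.MatrixMultiplication.…` repeats a component by design
set_option linter.dupNamespace false

namespace Summit.MatrixMultiplication.MatrixMultiplication.Theorems.BlockTensorTransfer

open scoped Computability
open Finset Literature.Computability.AutomaticStructures

noncomputable section

variable {p K N : ℕ} {ι : Type*}

/-- Membership in the language of block words, unfolded. -/
theorem mem_blockWords_iff (c : ZMod N → Fin K → Fin p) (D : ι → Finset (ZMod N))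
    (z : List (ι × Fin p)) :
    z ∈ ({z : List (ι × Fin p) | ∃ i s, s ∈ D i ∧ z = List.ofFn (fun j : Fin K => (i, c s j))} :
      Language (ι × Fin p)) ↔ ∃ i s, s ∈ D i ∧ z = List.ofFn (fun j : Fin K => (i, c s j)) :=
  Iff.rfl

/-- Block words have length `K`. -/
theorem length_eq_of_mem_blockWords (c : ZMod N → Fin K → Fin p) (D : ι → Finset (ZMod N)) :
    ∀ z ∈ ({z : List (ι × Fin p) | ∃ i s, s ∈ D i ∧ z = List.ofFn (fun j : Fin K => (i, c s j))} :
      Language (ι × Fin p)), z.length = K := by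
  intro z hz
  obtain ⟨i, s, -, rfl⟩ := (mem_blockWords_iff c D z).1 hz
  exact List.length_ofFn

/-- The index word that is constant `= i t` on block `t` (positions `finProdFinEquiv (t, j)`). Two such
words agree only if the block values agree (`K ≥ 1`). -/
theorem blockIndex_injective (hK : 0 < K) {m : ℕ} {i i' : Fin m → ι}
    (h : (fun q : Fin (m * K) => i (finProdFinEquiv.symm q).1) =
      fun q => i' (finProdFinEquiv.symm q).1) : i = i' := by
  funext t
  have := congrFun h (finProdFinEquiv (t, ⟨0, hK⟩))
  simpa only [Equiv.symm_apply_apply] using this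

/-- **Accepted words at scale `m * K`.** The word with index track `w` and digit track `a` lies in the
block-tensor language of `D` iff `w` is block-constant with values `i` and `a` is the concatenation
of the codes of elements `e t ∈ D (i t)`. -/
theorem ofFn_mem_blockLang_iff (hK : 0 < K) (c : ZMod N → Fin K → Fin p) (D : ι → Finset (ZMod N))
    {m : ℕ} (w : Fin (m * K) → ι) (a : Fin (m * K) → Fin p) :
    List.ofFn (fun q : Fin (m * K) => (w q, a q)) ∈
        ({z : List (ι × Fin p) | ∃ i s, s ∈ D i ∧ z = List.ofFn (fun j : Fin K => (i, c s j))}∗ :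
          Language (ι × Fin p)) ↔
      ∃ (i : Fin m → ι) (e : Fin m → ZMod N), (∀ t, e t ∈ D (i t)) ∧
        (w = fun q => i (finProdFinEquiv.symm q).1) ∧
        a = fun q => c (e (finProdFinEquiv.symm q).1) (finProdFinEquiv.symm q).2 := by
  rw [ofFn_mem_kstar_iff hK (length_eq_of_mem_blockWords c D)]
  constructor
  · intro h
    have h' : ∀ t : Fin m, ∃ (i : ι) (s : ZMod N), s ∈ D i ∧
        (fun j : Fin K => (w (finProdFinEquiv (t, j)), a (finProdFinEquiv (t, j)))) =
          fun j => (i, c s j) := by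
      intro t
      obtain ⟨i, s, hs, heq⟩ := (mem_blockWords_iff c D _).1 (h t)
      exact ⟨i, s, hs, List.ofFn_injective heq⟩
    choose i e he hblk using h'
    refine ⟨i, e, he, ?_, ?_⟩
    · funext q
      obtain ⟨⟨t, j⟩, rfl⟩ := finProdFinEquiv.surjective q
      rw [Equiv.symm_apply_apply]
      exact (Prod.ext_iff.1 (congrFun (hblk t) j)).1
    · funext q
      obtain ⟨⟨t, j⟩, rfl⟩ := finProdFinEquiv.surjective q
      rw [Equiv.symm_apply_apply]
      exact (Prod.ext_iff.1 (congrFun (hblk t) j)).2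
  · rintro ⟨i, e, he, rfl, rfl⟩ t
    refine (mem_blockWords_iff c D _).2 ⟨i t, e t, he t, ?_⟩
    simp only [Equiv.symm_apply_apply]

/-- **Value of a block-structured digit word**: if block `t` of `a` is the word `b t`, then
`[a]_p = ∑_t [b t]_p · p^(K t)`. -/
theorem digitValue_eq_sum_blocks {m : ℕ} (a : Fin (m * K) → Fin p) (b : Fin m → Fin K → Fin p)
    (h : ∀ t j, a (finProdFinEquiv (t, j)) = b t j) :
    digitValue a = ∑ t : Fin m, digitValue (b t) * p ^ (K * (t : ℕ)) := by
  unfold digitValue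
  rw [← Fintype.sum_equiv finProdFinEquiv
    (fun tj : Fin m × Fin K => (a (finProdFinEquiv tj) : ℕ) * p ^ ((finProdFinEquiv tj : Fin (m * K)) : ℕ))
    (fun q : Fin (m * K) => (a q : ℕ) * p ^ (q : ℕ)) (fun _ => rfl)]
  rw [Fintype.sum_prod_type]
  refine Finset.sum_congr rfl fun t _ => ?_
  rw [Finset.sum_mul]
  refine Finset.sum_congr rfl fun j _ => ?_
  rw [h t j, finProdFinEquiv_apply_val, pow_add]
  ring

/-- **The block over `w` at scale `m * K`**: its elements are the values
`∑_t [c (e t)]_p · p^(K t)` of the code concatenations of tuples `e t ∈ D (i t)`, where `w` must be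
the block-constant index word with values `i` (otherwise the block is empty). -/
theorem mem_automaticBlock_blockLang_iff (hK : 0 < K) (c : ZMod N → Fin K → Fin p)
    (D : ι → Finset (ZMod N)) {m : ℕ} (w : Fin (m * K) → ι) (x : ZMod (p ^ (m * K))) :
    x ∈ automaticBlock p (m * K)
        ({z : List (ι × Fin p) | ∃ i s, s ∈ D i ∧ z = List.ofFn (fun j : Fin K => (i, c s j))}∗ :
          Language (ι × Fin p)) w ↔
      ∃ (i : Fin m → ι) (e : Fin m → ZMod N), (∀ t, e t ∈ D (i t)) ∧
        (w = fun q => i (finProdFinEquiv.symm q).1) ∧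
        x = ((∑ t : Fin m, digitValue (c (e t)) * p ^ (K * (t : ℕ)) : ℕ) : ZMod (p ^ (m * K))) := by
  rw [mem_automaticBlock]
  constructor
  · rintro ⟨a, ha, rfl⟩
    obtain ⟨i, e, he, hw, rfl⟩ := (ofFn_mem_blockLang_iff hK c D w a).1 ha
    refine ⟨i, e, he, hw, ?_⟩
    rw [digitValue_eq_sum_blocks _ (fun t => c (e t)) (fun t j => by
      simp only [Equiv.symm_apply_apply])]
  · rintro ⟨i, e, he, hw, rfl⟩
    refine ⟨fun q => c (e (finProdFinEquiv.symm q).1) (finProdFinEquiv.symm q).2,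
      (ofFn_mem_blockLang_iff hK c D w _).2 ⟨i, e, he, hw, rfl⟩, ?_⟩
    rw [digitValue_eq_sum_blocks _ (fun t => c (e t)) (fun t j => by
      simp only [Equiv.symm_apply_apply])]

/-- **Cardinality of the block over a block-constant index word** (injective coding): it is the
product `∏_t |D (i t)|` (CKSU 2005, Lemma 5.4: the level-`m K` family is the `m`-fold product
design). -/
theorem card_automaticBlock_blockLang (hK : 0 < K) {c : ZMod N → Fin K → Fin p}
    (hc : Function.Injective c) (D : ι → Finset (ZMod N)) {m : ℕ} (i : Fin m → ι) :
    (automaticBlock p (m * K)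
        ({z : List (ι × Fin p) | ∃ i s, s ∈ D i ∧ z = List.ofFn (fun j : Fin K => (i, c s j))}∗ :
          Language (ι × Fin p)) (fun q => i (finProdFinEquiv.symm q).1)).card =
      ∏ t, (D (i t)).card := by
  classical
  rw [card_automaticBlock]
  -- the accepted digit words are the code concatenations of the tuples in `∏_t D (i t)`
  set Φ : (Fin m → ZMod N) → (Fin (m * K) → Fin p) :=
    fun e q => c (e (finProdFinEquiv.symm q).1) (finProdFinEquiv.symm q).2 with hΦ
  have hinj : Function.Injective Φ := by
    intro e e' h
    funext t
    apply hc
    funext j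
    have := congrFun h (finProdFinEquiv (t, j))
    simpa only [hΦ, Equiv.symm_apply_apply] using this
  rw [← Fintype.card_piFinset fun t => D (i t), ← Finset.card_image_of_injective _ hinj]
  congr 1
  ext a
  rw [Finset.mem_filter, Finset.mem_image, ofFn_mem_blockLang_iff hK c D]
  constructor
  · rintro ⟨-, i', e, he, hw, rfl⟩
    obtain rfl : i = i' := blockIndex_injective hK hw
    exact ⟨e, Fintype.mem_piFinset.2 he, rfl⟩
  · rintro ⟨e, he, rfl⟩
    exact ⟨Finset.mem_univ _, i, e, Fintype.mem_piFinset.1 he, rfl, rfl⟩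

/-- **Balanced base-`B` digits of zero vanish.** If `|E t| < B` for all `t < m` and
`B^m ∣ ∑_t E t · B^t`, then every `E t` is zero. -/
theorem eq_zero_of_pow_dvd_sum (B : ℤ) :
    ∀ (m : ℕ) (E : Fin m → ℤ), (∀ t, |E t| < B) → B ^ m ∣ ∑ t : Fin m, E t * B ^ (t : ℕ) →
      ∀ t, E t = 0 := by
  intro m
  induction m with
  | zero => intro E _ _ t; exact t.elim0
  | succ m ih =>
    intro E hE hdvd
    have hB : B ≠ 0 := by
      have h0 := hE 0
      have := abs_nonneg (E 0)
      intro hB; rw [hB] at h0; exact absurd (h0.trans_le' this) (lt_irrefl 0)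
    rw [Fin.sum_univ_succ] at hdvd
    simp only [Fin.val_zero, pow_zero, mul_one, Fin.val_succ, pow_succ] at hdvd
    have hsum : ∑ t : Fin m, E t.succ * (B ^ (t : ℕ) * B) = (∑ t : Fin m, E t.succ * B ^ (t : ℕ)) * B := by
      rw [Finset.sum_mul]
      exact Finset.sum_congr rfl fun t _ => by ring
    rw [hsum] at hdvd
    -- position `0`: `B ∣ E 0`, hence `E 0 = 0`
    have hB0 : B ∣ E 0 := by
      have h1 : B ∣ E 0 + (∑ t : Fin m, E t.succ * B ^ (t : ℕ)) * B :=
        (dvd_pow_self B (Nat.succ_ne_zero m)).trans (by rwa [pow_succ])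
      exact (dvd_add_left (dvd_mul_left B _)).1 h1
    have hE0 : E 0 = 0 := Int.eq_zero_of_abs_lt_dvd hB0 (hE 0)
    rw [hE0, zero_add] at hdvd
    -- the remaining positions: cancel one factor `B` and use the induction hypothesis
    have hdvd' : B ^ m ∣ ∑ t : Fin m, E t.succ * B ^ (t : ℕ) := (mul_dvd_mul_iff_right hB).1 hdvd
    have htail := ih (fun t => E t.succ) (fun t => hE t.succ) hdvd'
    intro t
    refine Fin.cases hE0 (fun t => htail t) t

/-- **Blockwise STPP relation** (no carry crosses a block). For six tuples `e₁ … e₆ : Fin m → ZMod N`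
with `3 N ≤ p^K`: if the values `X e = ∑_t (e t).val · p^(K t)` satisfy the STPP relation
`(X e₂ - X e₁) + (X e₄ - X e₃) + (X e₆ - X e₅) = 0` in `ZMod (p^(m K))`, then the relation
`(e₂ t - e₁ t) + (e₄ t - e₃ t) + (e₆ t - e₅ t) = 0` holds in `ZMod N` for every block `t`
(the integer block combinations have absolute value `≤ 3(N-1) < p^K`). -/
theorem blockwise_stpp_relation [NeZero N] (hN : 3 * N ≤ p ^ K) {m : ℕ}
    (e₁ e₂ e₃ e₄ e₅ e₆ : Fin m → ZMod N)
    (h : (((∑ t : Fin m, (e₂ t).val * p ^ (K * (t : ℕ)) : ℕ) : ZMod (p ^ (m * K))) -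
            ((∑ t : Fin m, (e₁ t).val * p ^ (K * (t : ℕ)) : ℕ) : ZMod (p ^ (m * K)))) +
          (((∑ t : Fin m, (e₄ t).val * p ^ (K * (t : ℕ)) : ℕ) : ZMod (p ^ (m * K))) -
            ((∑ t : Fin m, (e₃ t).val * p ^ (K * (t : ℕ)) : ℕ) : ZMod (p ^ (m * K)))) +
          (((∑ t : Fin m, (e₆ t).val * p ^ (K * (t : ℕ)) : ℕ) : ZMod (p ^ (m * K))) -
            ((∑ t : Fin m, (e₅ t).val * p ^ (K * (t : ℕ)) : ℕ) : ZMod (p ^ (m * K)))) = 0) :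
    ∀ t, (e₂ t - e₁ t) + (e₄ t - e₃ t) + (e₆ t - e₅ t) = 0 := by
  -- the integer block combinations
  set E : Fin m → ℤ := fun t =>
    (((e₂ t).val : ℤ) - (e₁ t).val) + (((e₄ t).val : ℤ) - (e₃ t).val) +
      (((e₆ t).val : ℤ) - (e₅ t).val) with hE
  set B : ℤ := (p : ℤ) ^ K with hB
  have hEB : ∀ t, |E t| < B := by
    intro t
    have h1 := ZMod.val_lt (e₁ t); have h2 := ZMod.val_lt (e₂ t); have h3 := ZMod.val_lt (e₃ t)
    have h4 := ZMod.val_lt (e₄ t); have h5 := ZMod.val_lt (e₅ t); have h6 := ZMod.val_lt (e₆ t)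
    have hN' : ((3 * N : ℕ) : ℤ) ≤ B := by rw [hB]; exact_mod_cast hN
    rw [abs_lt, hE]
    push_cast at hN' ⊢
    constructor <;> omega
  -- the relation, as an integer congruence mod `p^(m K) = B^m`
  have hcast : ((∑ t : Fin m, E t * B ^ (t : ℕ) : ℤ) : ZMod (p ^ (m * K))) = 0 := by
    rw [← h, hE, hB]
    push_cast
    simp only [Finset.sum_add_distrib, Finset.sum_sub_distrib, add_mul, sub_mul, ← pow_mul]
  rw [ZMod.intCast_zmod_eq_zero_iff_dvd] at hcast
  have hdvd : B ^ m ∣ ∑ t : Fin m, E t * B ^ (t : ℕ) := by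
    rw [hB, ← pow_mul, mul_comm K m]; exact_mod_cast hcast
  have hzero := eq_zero_of_pow_dvd_sum B m E hEB hdvd
  intro t
  have ht := hzero t
  have hcastN : ((E t : ℤ) : ZMod N) = (e₂ t - e₁ t) + (e₄ t - e₃ t) + (e₆ t - e₅ t) := by
    rw [hE]
    push_cast
    simp only [ZMod.natCast_val, ZMod.cast_id', id]
  rw [← hcastN, ht, Int.cast_zero]

/-- **STPP at scale `m * K`.** For an STPP design `(A, B, C)` in `ZMod N` (route predicate `IsSTPP`),
`3 N ≤ p^K` and a coding `c` with `[c s]_p = s.val`, the three block families of the block-tensor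
languages at scale `m K`, indexed by index words `w : Fin (m K) → Fin n`, form an STPP family in
`ZMod (p^(m K))` (CKSU 2005, Lemma 5.4, carry-free). -/
theorem addSimultaneousTPP_automaticBlock_blockLang_mul (hK : 0 < K) [NeZero N]
    (hN : 3 * N ≤ p ^ K) (c : ZMod N → Fin K → Fin p) (hc : ∀ s, digitValue (c s) = s.val)
    {n : ℕ} (A B C : Fin n → Finset (ZMod N))
    (hS : Literature.Computability.AlgebraicComplexity.IsSTPP A B C) (m : ℕ) :
    Literature.Combinatorics.Additive.AddSimultaneousTPP
      (fun w : Fin (m * K) → Fin n => automaticBlock p (m * K)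
        ({z : List (Fin n × Fin p) | ∃ i s, s ∈ A i ∧ z = List.ofFn (fun j : Fin K => (i, c s j))}∗ :
          Language (Fin n × Fin p)) w)
      (fun w => automaticBlock p (m * K)
        ({z : List (Fin n × Fin p) | ∃ i s, s ∈ B i ∧ z = List.ofFn (fun j : Fin K => (i, c s j))}∗ :
          Language (Fin n × Fin p)) w)
      (fun w => automaticBlock p (m * K)
        ({z : List (Fin n × Fin p) | ∃ i s, s ∈ C i ∧ z = List.ofFn (fun j : Fin K => (i, c s j))}∗ :
          Language (Fin n × Fin p)) w) := by
  rw [Literature.Combinatorics.Additive.addSimultaneousTPP_iff_forall]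
  intro w₁ w₂ w₃ s hs s' hs' t ht t' ht' u hu u' hu' h0
  rw [mem_automaticBlock_blockLang_iff hK c] at hs hs' ht ht' hu hu'
  obtain ⟨i₃, e₁, he₁, hw₃, rfl⟩ := hs
  obtain ⟨i₁, e₂, he₂, hw₁, rfl⟩ := hs'
  obtain ⟨i₁', e₃, he₃, hw₁', rfl⟩ := ht
  obtain ⟨i₂, e₄, he₄, hw₂, rfl⟩ := ht'
  obtain ⟨i₂', e₅, he₅, hw₂', rfl⟩ := hu
  obtain ⟨i₃', e₆, he₆, hw₃', rfl⟩ := hu'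
  obtain rfl : i₁ = i₁' := blockIndex_injective hK (hw₁.symm.trans hw₁')
  obtain rfl : i₂ = i₂' := blockIndex_injective hK (hw₂.symm.trans hw₂')
  obtain rfl : i₃ = i₃' := blockIndex_injective hK (hw₃.symm.trans hw₃')
  simp only [hc] at h0
  have hblk := blockwise_stpp_relation hN e₁ e₂ e₃ e₄ e₅ e₆ h0
  have key : ∀ q, i₁ q = i₂ q ∧ i₂ q = i₃ q ∧ e₁ q = e₂ q ∧ e₃ q = e₄ q ∧ e₅ q = e₆ q :=
    fun q => hS (i₁ q) (i₂ q) (i₃ q) (e₁ q) (he₁ q) (e₂ q) (he₂ q) (e₃ q) (he₃ q) (e₄ q) (he₄ q)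
      (e₅ q) (he₅ q) (e₆ q) (he₆ q) (hblk q)
  have h12 : i₁ = i₂ := funext fun q => (key q).1
  have h23 : i₂ = i₃ := funext fun q => (key q).2.1
  have g12 : e₁ = e₂ := funext fun q => (key q).2.2.1
  have g34 : e₃ = e₄ := funext fun q => (key q).2.2.2.1
  have g56 : e₅ = e₆ := funext fun q => (key q).2.2.2.2
  subst h12 h23 g12 g34 g56
  exact ⟨hw₁.trans hw₂.symm, hw₂.trans hw₃.symm, rfl, rfl, rfl⟩

/-- **STPP at every scale.** As `addSimultaneousTPP_automaticBlock_blockLang_mul`, at an arbitrary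
scale `k`: if `K ∤ k` every block is empty. -/
theorem addSimultaneousTPP_automaticBlock_blockLang (hK : 0 < K) [NeZero N]
    (hN : 3 * N ≤ p ^ K) (c : ZMod N → Fin K → Fin p) (hc : ∀ s, digitValue (c s) = s.val)
    {n : ℕ} (A B C : Fin n → Finset (ZMod N))
    (hS : Literature.Computability.AlgebraicComplexity.IsSTPP A B C) (k : ℕ) :
    Literature.Combinatorics.Additive.AddSimultaneousTPP
      (fun w : Fin k → Fin n => automaticBlock p k
        ({z : List (Fin n × Fin p) | ∃ i s, s ∈ A i ∧ z = List.ofFn (fun j : Fin K => (i, c s j))}∗ :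
          Language (Fin n × Fin p)) w)
      (fun w => automaticBlock p k
        ({z : List (Fin n × Fin p) | ∃ i s, s ∈ B i ∧ z = List.ofFn (fun j : Fin K => (i, c s j))}∗ :
          Language (Fin n × Fin p)) w)
      (fun w => automaticBlock p k
        ({z : List (Fin n × Fin p) | ∃ i s, s ∈ C i ∧ z = List.ofFn (fun j : Fin K => (i, c s j))}∗ :
          Language (Fin n × Fin p)) w) := by
  by_cases hk : K ∣ k
  · obtain ⟨m, rfl⟩ : ∃ m, k = m * K := ⟨k / K, (Nat.div_mul_cancel hk).symm⟩
    exact addSimultaneousTPP_automaticBlock_blockLang_mul hK hN c hc A B C hS m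
  · -- every block is empty
    have hempty : ∀ (D : Fin n → Finset (ZMod N)) (w : Fin k → Fin n) (x : ZMod (p ^ k)),
        x ∉ automaticBlock p k
          ({z : List (Fin n × Fin p) | ∃ i s, s ∈ D i ∧ z = List.ofFn (fun j : Fin K => (i, c s j))}∗ :
            Language (Fin n × Fin p)) w := by
      intro D w x hx
      rw [mem_automaticBlock] at hx
      obtain ⟨a, ha, -⟩ := hx
      have hdvd := length_dvd_of_mem_kstar (length_eq_of_mem_blockWords c D) ha
      rw [List.length_ofFn] at hdvd
      exact hk hdvd
    rw [Literature.Combinatorics.Additive.addSimultaneousTPP_iff_forall]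
    intro w₁ w₂ w₃ s hs
    exact absurd hs (hempty A w₃ s)

/-- **Packing sum of the block-tensor family.** At scale `m K` the packing sum at exponent `τ` of
the block families is at least the `m`-th power of the design's packing sum
`∑_i (|A i| |B i| |C i|)^τ` (the block-constant index words alone contribute the `m`-fold product
design, whose packing sum is multiplicative). -/
theorem pow_sum_rpow_le_sum_automaticBlock_blockLang (hK : 0 < K) {c : ZMod N → Fin K → Fin p}
    (hc : Function.Injective c) {n : ℕ} (A B C : Fin n → Finset (ZMod N)) (τ : ℝ) (m : ℕ) :
    (∑ i : Fin n, (((A i).card * (B i).card * (C i).card : ℕ) : ℝ) ^ τ) ^ m ≤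
      ∑ w : Fin (m * K) → Fin n,
        (((automaticBlock p (m * K)
            ({z : List (Fin n × Fin p) | ∃ i s, s ∈ A i ∧ z = List.ofFn (fun j : Fin K => (i, c s j))}∗ :
              Language (Fin n × Fin p)) w).card *
          (automaticBlock p (m * K)
            ({z : List (Fin n × Fin p) | ∃ i s, s ∈ B i ∧ z = List.ofFn (fun j : Fin K => (i, c s j))}∗ :
              Language (Fin n × Fin p)) w).card *
          (automaticBlock p (m * K)
            ({z : List (Fin n × Fin p) | ∃ i s, s ∈ C i ∧ z = List.ofFn (fun j : Fin K => (i, c s j))}∗ :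
              Language (Fin n × Fin p)) w).card : ℕ) : ℝ) ^ τ := by
  classical
  -- the block-constant index words
  set ω : (Fin m → Fin n) → (Fin (m * K) → Fin n) :=
    fun i q => i (finProdFinEquiv.symm q).1 with hω
  have hωinj : Function.Injective ω := fun i i' h => blockIndex_injective hK h
  -- left-hand side: expand the power of the sum over tuples
  have hlhs : (∑ i : Fin n, (((A i).card * (B i).card * (C i).card : ℕ) : ℝ) ^ τ) ^ m =
      ∑ i : Fin m → Fin n, ∏ t, (((A (i t)).card * (B (i t)).card * (C (i t)).card : ℕ) : ℝ) ^ τ := by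
    rw [Finset.sum_pow', Fintype.piFinset_univ]
  rw [hlhs]
  -- each tuple's term is the term of the corresponding block-constant index word
  have hterm : ∀ i : Fin m → Fin n,
      ∏ t, (((A (i t)).card * (B (i t)).card * (C (i t)).card : ℕ) : ℝ) ^ τ =
        (((automaticBlock p (m * K)
            ({z : List (Fin n × Fin p) | ∃ i s, s ∈ A i ∧ z = List.ofFn (fun j : Fin K => (i, c s j))}∗ :
              Language (Fin n × Fin p)) (ω i)).card *
          (automaticBlock p (m * K)
            ({z : List (Fin n × Fin p) | ∃ i s, s ∈ B i ∧ z = List.ofFn (fun j : Fin K => (i, c s j))}∗ :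
              Language (Fin n × Fin p)) (ω i)).card *
          (automaticBlock p (m * K)
            ({z : List (Fin n × Fin p) | ∃ i s, s ∈ C i ∧ z = List.ofFn (fun j : Fin K => (i, c s j))}∗ :
              Language (Fin n × Fin p)) (ω i)).card : ℕ) : ℝ) ^ τ := by
    intro i
    rw [hω, card_automaticBlock_blockLang hK hc A i, card_automaticBlock_blockLang hK hc B i,
      card_automaticBlock_blockLang hK hc C i, ← Finset.prod_mul_distrib, ← Finset.prod_mul_distrib,
      Nat.cast_prod, ← Real.finsetProd_rpow _ _ (fun t _ => by positivity)]
  calc ∑ i : Fin m → Fin n, ∏ t, (((A (i t)).card * (B (i t)).card * (C (i t)).card : ℕ) : ℝ) ^ τ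
      = ∑ w ∈ (Finset.univ : Finset (Fin m → Fin n)).image ω,
          (((automaticBlock p (m * K)
            ({z : List (Fin n × Fin p) | ∃ i s, s ∈ A i ∧ z = List.ofFn (fun j : Fin K => (i, c s j))}∗ :
              Language (Fin n × Fin p)) w).card *
          (automaticBlock p (m * K)
            ({z : List (Fin n × Fin p) | ∃ i s, s ∈ B i ∧ z = List.ofFn (fun j : Fin K => (i, c s j))}∗ :
              Language (Fin n × Fin p)) w).card *
          (automaticBlock p (m * K)
            ({z : List (Fin n × Fin p) | ∃ i s, s ∈ C i ∧ z = List.ofFn (fun j : Fin K => (i, c s j))}∗ :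
              Language (Fin n × Fin p)) w).card : ℕ) : ℝ) ^ τ := by
        rw [Finset.sum_image fun i _ i' _ h => hωinj h]
        exact Finset.sum_congr rfl fun i _ => hterm i
    _ ≤ _ := Finset.sum_le_sum_of_subset_of_nonneg (Finset.subset_univ _)
          fun w _ _ => by positivity

end

end Summit.MatrixMultiplication.MatrixMultiplication.Theorems.BlockTensorTransfer
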